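import Literature.AlgebraicGeometry.HodgeTheory.WeilClassesFieldExceptionalOfCentralTrace
import Mathlib.RingTheory.Adjoin.Polynomial.Basic
import Mathlib.LinearAlgebra.Eigenspace.Minpoly
import HarnessLib

/-!
# A non-zero Rosati-antisymmetric CENTRAL element of `F` makes all non-zero Weil classes of `F` exceptional:
# «if `E ∩ F` is not totally real, then `θ ≠ 0`» (Moonen–Zarhin 1998 §1, Remark (2) after Criterion (2)), on the
# carrier, for every complex abelian variety

Layer `Literature/AlgebraicGeometry/HodgeTheory`; THEOREMS ONLY (no definition, no named fact; D-0026 net debt 0).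
Sequel of `WeilClassesFieldExceptionalOfCentralTrace` («`θ ≠ 0 ⟹` all non-zero classes of `W_F` exceptional», for
EVERY `A`: a central `u ∈ End(A)` whose `E₋`-part `w = u^* - (u^*)†` has non-zero trace on some eigenspace `V_ρ` of
`F` kills decomposability), which is fed with the print's witness of Remark (2): an element `α ∈ E ∩ F` with
`α† = -α`, `α ≠ 0`, for which `θ(α) = Tr_F(α) = dim_F(V_X) · α ≠ 0` «obviously».

## The print

B. J. J. Moonen, Yu. G. Zarhin, *Weil classes on abelian varieties*, J. reine angew. Math. **496** (1998) =
arXiv:alg-geom/9612017 [MoonenZarhin1998WeilClasses], §1 (held chunks p0003 L46–L60, p0004 L48–L53), VERBATIM.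
Criterion (2): «… or all non-zero classes in `W_F` are exceptional; this last possibility occurs precisely in the
following cases: `Y` is of Type 3, `m = 1` and `F ⊄ E`; `Y` is of Type 3, `m ≥ 2` and the integer `2m·[E:ℚ]/[F:ℚ]` is
odd; `Y` is of Type 4, `d = 1`, `m = 1` and `F ⊄ E₀`; `Y` is of Type 4 with `d ≥ 2` or `m ≥ 2` and the map
`θ : E₋ ↪ End_F(V_X) —Tr_F→ F` is non-zero.» Remark (2) after it: «Assume `X` is of type 4 with either `d ≥ 2` or
`m ≥ 2`. If the map `θ : E₋ ↪ End_F(V_X) —Tr_F→ F` is zero, then the intersection `E ∩ F` is a totally real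
subfield of `E`, i.e., `E ∩ F ⊆ E₀`. In fact, if `E ∩ F` is not totally real, then (being a CM-subfield of `E`) it
must contain totally imaginary elements `0 ≠ α ∈ E₋`, which then obviously have a non-zero trace over `F`.»

## What is proved — for EVERY complex abelian variety (no Albert type, no `d`, `m`)

Carrier dictionary as in the seat's files: `F = ℚ(φ)`, `P(φ) = 0`, `P ∈ ℤ[T]` monic irreducible of degree `e`,
`e · 2m = 2 dim A`, `V_ρ = ker(φ^* - ρ)`, `W_F ⊗ ℂ = weilClassesField A φ P (2m)`, `𝒟ᵐ ⊗ ℂ = divisorClassesSpan A.X (dim A) m`,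
`h` a polarization class (rational, `(1,1)`, hard Lefschetz), `E ⊗ ℂ` = the central pull-backs
(`Milne1999.centralizerAlgebra A ∋ u^*`), `†` = the `Q_h`-adjoint.  «`α ∈ E ∩ F`, `α ∈ E₋`, `α ≠ 0`» is read as: an
endomorphism `u ∈ End(A)` whose pull-back `u^*` is a polynomial in `φ^*` (`u^* ∈ ℂ[φ^*] = F ⊗ ℂ` acting), is
central (`u^* ∈ C(A) ⊗ ℂ`), is `Q_h`-antisymmetric (`Q_h(u^* x, y) = -Q_h(x, u^* y)`, i.e. `(u^*)† = -u^*`) and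
non-zero.

* §1 `exists_forall_apply_eq_eval_smul_of_mem_adjoin` — an element `T = p(φ^*)` of `ℂ[φ^*]` acts on `V_ρ` by the
  scalar `p(ρ)`; `exists_root_apply_ne_zero_of_ne_zero` — if `T ≠ 0` there are a complex root `ρ` of `P` and a
  non-zero `v ∈ V_ρ` with `T v ≠ 0` (`H¹ = ⊕_ρ V_ρ`, the tree's `exists_eigenbasis_complexBetti_one`).
* §2 **`exists_root_trace_restrict_ne_zero`** — «obviously have a non-zero trace over `F`»: for `u^* ∈ ℂ[φ^*]` non-zero,
  the `E₋`-element `w = u^* - (-u^*) = 2u^*` has `Tr(w | V_ρ) = 2 p(ρ) · dim V_ρ ≠ 0` at such a root.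
* §3 **`weilClassesField_inf_divisorClassesSpan_eq_bot_of_central_skew`** — THE STATEMENT: a non-zero central
  `Q_h`-antisymmetric `u` with `u^* ∈ ℂ[φ^*]` forces `W_F ⊗ ℂ ⊓ 𝒟ᵐ ⊗ ℂ = ⊥` (`m ≠ 0`): all non-zero Weil classes of `F`
  are exceptional (Remark (2) + `WeilClassesFieldExceptionalOfCentralTrace`). With Criterion (1):
  **`weilClassesField_le_hodgeClassSpan_and_inf_eq_bot_of_central_skew`** — if moreover `n_ρ = n_ρ̄` at every root,
  `W_F` consists of HODGE classes all of whose non-zero members are exceptional.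
* §4 **`weilClassesField_inf_divisorClassesSpan_eq_bot_of_generator_central_skew`** — the generator itself: if `φ^*`
  is central and `Q_h`-antisymmetric (`φ† = -φ`, e.g. `φ² = -d`: Weil's `k = ℚ(√-d) ⊆ Z(End⁰ X)`), all non-zero
  classes of `W_F` are exceptional. This covers, on the carrier, the Criterion's case «Type 4, `d = 1`, `m = 1`
  (so `End⁰(X) = E` is commutative and `F ⊆ E`) and `F ⊄ E₀`»: a subfield of the CM field `E` not inside `E₀`
  contains a non-zero element of `E₋`.

NOT here: the converse («`θ = 0 ⟹` decomposable», Remark (3); needs `G_div` connected), Albert types, «`E ∩ F` is a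
CM-subfield» (number-field bookkeeping: the tree's `NumberFields/CMFieldImaginaryTraceOverDisjointField`).

## References

* [MoonenZarhin1998WeilClasses] B. J. J. Moonen, Yu. G. Zarhin, J. reine angew. Math. 496 (1998) =
  arXiv:alg-geom/9612017, §1 Criterion (2) (chunk p0003 L46–L60) and Remark (2) after it (chunk p0004 L48–L53).
* [Weil1977HodgeRing] A. Weil, *Abelian varieties and the Hodge ring*, Œuvres III [1977c], 421–429 (the
  imaginary quadratic case).
* [Milne1999LefschetzClasses] J. S. Milne, Duke Math. J. 96 (1999), §1 pp. 642–644 (`C(A)`, `†`).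
* [vanGeemen1994HodgeAV] B. van Geemen, LNM 1594 (1994), 2.4–2.5, 6.9–6.12 (Weil's classes for `ℚ(√-d)`).

## Provenance

Lane `lit-hodgefound` (Track 2, Layer A), prover seat `lit-hodgefound-p21` (generation 14), row g14-#4.
-/

noncomputable section

open CategoryTheory Polynomial Module

namespace Literature.AlgebraicGeometry.HodgeTheory

open Literature.AlgebraicGeometry.Motives
open Literature.AlgebraicGeometry.VanGeemen1994 (hodgeClassSpan pullbackOne detOnEigenspace)
open Literature.AlgebraicGeometry.Milne1999 (centralizerAlgebra unitaryCentralizerGroup)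
open Literature.AlgebraicTopology.SingularHomology
open Literature.Barriers.HodgeConjecture (divisorClassesSpan)
open Literature.Geometry.Kaehler (HasHardLefschetzProperty)

section HodgeTheory

variable {A : AbelianVariety ℂ} {φ : A ⟶ A} {P : Polynomial ℤ} {e m : ℕ} {h : complexBetti A.X 2}

/-! ### §1 Elements of `ℂ[φ^*] = F ⊗ ℂ` act on the eigenspaces `V_ρ` of `φ^*` by scalars -/

/-- **`p(φ^*)` acts on `V_ρ = ker(φ^* - ρ)` by the scalar `p(ρ)`**: an element `T` of the subalgebra `ℂ[φ^*]`
generated by `φ^*` (the action of `F ⊗ ℂ`, `F = ℚ(φ)`) is `p(φ^*)` for a polynomial `p` (Mathlib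
`Algebra.adjoin_singleton_eq_range_aeval`), and `p(φ^*) v = p(ρ) v` on eigenvectors
(`Module.End.aeval_apply_of_hasEigenvector`) — the complexification `F ⊗_{ℚ} ℂ = ∏_σ ℂ` acting on `V_ℂ = ⊕_σ V_{ℂ,σ}`.
[cite: MoonenZarhin1998WeilClasses, §1 (the decomposition V_ℂ = ⊕_σ V_{ℂ,σ}; chunk p0001)] -/
theorem exists_forall_apply_eq_eval_smul_of_mem_adjoin {T : Module.End ℂ (complexBetti A.X 1)}
    (hT : T ∈ Algebra.adjoin ℂ ({pullbackOne A φ} : Set (Module.End ℂ (complexBetti A.X 1)))) :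
    ∃ p : ℂ[X], ∀ (ρ : ℂ), ∀ v ∈ Module.End.eigenspace (pullbackOne A φ) ρ, T v = p.eval ρ • v := by
  rw [Algebra.adjoin_singleton_eq_range_aeval] at hT
  obtain ⟨p, rfl⟩ := hT
  refine ⟨p, fun ρ v hv ↦ ?_⟩
  by_cases hv0 : v = 0
  · rw [hv0, map_zero, smul_zero]
  · exact Module.End.aeval_apply_of_hasEigenvector ⟨hv, hv0⟩

/-- **A non-zero element of `ℂ[φ^*]` is non-zero on some eigenspace**: if `T ∈ ℂ[φ^*]`, `T ≠ 0`, there are a complex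
root `ρ` of `P` and `v ∈ V_ρ` with `T v ≠ 0` (`H¹(A(ℂ); ℂ) = ⊕_ρ V_ρ` through an eigenbasis of `φ^*`, the tree's
`exists_eigenbasis_complexBetti_one`; `P` irreducible with `P(φ) = 0`). [cite: MoonenZarhin1998WeilClasses, §1 (V_ℂ = ⊕_σ V_{ℂ,σ}; chunk p0001)] -/
theorem exists_root_apply_ne_zero_of_ne_zero (hPirr : Irreducible (P.map (Int.castRingHom ℚ)))
    (hφ : Polynomial.eval₂ (Int.castRingHom (CategoryTheory.End A)) (φ : CategoryTheory.End A) P = 0)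
    {T : Module.End ℂ (complexBetti A.X 1)} (hT0 : T ≠ 0) :
    ∃ ρ : ℂ, Polynomial.eval₂ (Int.castRingHom ℂ) ρ P = 0 ∧
      ∃ v ∈ Module.End.eigenspace (pullbackOne A φ) ρ, v ≠ 0 ∧ T v ≠ 0 := by
  classical
  obtain ⟨N, b, lam, hlamP, hb⟩ := exists_eigenbasis_complexBetti_one hPirr hφ
  by_contra hne
  push Not at hne
  apply hT0
  refine b.ext fun i ↦ ?_
  rw [LinearMap.zero_apply]
  exact hne (lam i) (hlamP i) (b i) (hb i) (b.ne_zero i)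

/-! ### §2 «… which then obviously have a non-zero trace over `F`» -/

/-- **`Tr(2u^* | V_ρ) ≠ 0` at some root** for a non-zero `u^* ∈ ℂ[φ^*]`: `u^*` acts on `V_ρ` by `p(ρ)`, so
`w = u^* - (-u^*) = 2u^*` acts by `2p(ρ)` and `Tr(w | V_ρ) = 2 p(ρ) · dim V_ρ`, non-zero as soon as `p(ρ) ≠ 0`
(characteristic `0`, `V_ρ ≠ 0`) — the print's «`θ(α) = Tr_F(α)` … obviously non-zero» for `α ∈ F`, `α ≠ 0`,
read at one complex place of `F`. [cite: MoonenZarhin1998WeilClasses, §1 Remark (2) after Criterion (2) (chunk p0004 L48–L53)] -/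
theorem exists_root_trace_restrict_ne_zero (hPirr : Irreducible (P.map (Int.castRingHom ℚ)))
    (hφ : Polynomial.eval₂ (Int.castRingHom (CategoryTheory.End A)) (φ : CategoryTheory.End A) P = 0)
    {u : A ⟶ A} (huF : pullbackOne A u ∈ Algebra.adjoin ℂ ({pullbackOne A φ} : Set (Module.End ℂ (complexBetti A.X 1))))
    (hu0 : pullbackOne A u ≠ 0) :
    ∃ (ρ : ℂ) (_ : Polynomial.eval₂ (Int.castRingHom ℂ) ρ P = 0)
      (hw : ∀ x ∈ Module.End.eigenspace (pullbackOne A φ) ρ,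
        (pullbackOne A u - -pullbackOne A u) x ∈ Module.End.eigenspace (pullbackOne A φ) ρ),
      LinearMap.trace ℂ _ ((pullbackOne A u - -pullbackOne A u).restrict hw) ≠ 0 := by
  haveI : Module.Finite ℂ (complexBetti A.X 1) := abelianVarietyCohomologyExteriorH1_holds.finite_one A
  obtain ⟨p, hp⟩ := exists_forall_apply_eq_eval_smul_of_mem_adjoin huF
  obtain ⟨ρ, hρ, v, hv, hv0, hTv⟩ := exists_root_apply_ne_zero_of_ne_zero hPirr hφ hu0
  -- `p(ρ) ≠ 0`
  have hpρ : p.eval ρ ≠ 0 := by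
    intro h0
    exact hTv (by rw [hp ρ v hv, h0, zero_smul])
  -- `w = 2u^*` acts on `V_ρ` by `2 p(ρ)`
  have hw2 : ∀ x, (pullbackOne A u - -pullbackOne A u) x = (2 : ℂ) • pullbackOne A u x := fun x ↦ by
    rw [LinearMap.sub_apply, LinearMap.neg_apply, sub_neg_eq_add, two_smul]
  have hw : ∀ x ∈ Module.End.eigenspace (pullbackOne A φ) ρ,
      (pullbackOne A u - -pullbackOne A u) x ∈ Module.End.eigenspace (pullbackOne A φ) ρ := fun x hx ↦ by
    rw [hw2, hp ρ x hx, smul_smul]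
    exact Submodule.smul_mem _ _ hx
  refine ⟨ρ, hρ, hw, ?_⟩
  have hrestr : (pullbackOne A u - -pullbackOne A u).restrict hw =
      ((2 : ℂ) * p.eval ρ) • (LinearMap.id : Module.End.eigenspace (pullbackOne A φ) ρ →ₗ[ℂ] _) := by
    refine LinearMap.ext fun x ↦ Subtype.ext ?_
    rw [LinearMap.coe_restrict_apply, LinearMap.smul_apply, LinearMap.id_apply, Submodule.coe_smul, hw2,
      hp ρ x x.2, smul_smul]
  have hpos : 0 < Module.finrank ℂ (Module.End.eigenspace (pullbackOne A φ) ρ) :=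
    Module.finrank_pos_iff_exists_ne_zero.2 ⟨⟨v, hv⟩, fun h0 ↦ hv0 (congrArg Subtype.val h0)⟩
  rw [hrestr, map_smul, LinearMap.trace_id, smul_eq_mul]
  exact mul_ne_zero (mul_ne_zero two_ne_zero hpρ) (Nat.cast_ne_zero.2 hpos.ne')

/-! ### §3 «If `E ∩ F` is not totally real then `θ ≠ 0`» ⟹ all non-zero classes of `W_F` are exceptional -/

/-- **MOONEN–ZARHIN, REMARK (2) WITH CRITERION (2), PROVED ON THE CARRIER FOR EVERY COMPLEX ABELIAN VARIETY: a
non-zero central Rosati-antisymmetric element of `F` makes all non-zero Weil classes of `F` exceptional.**  Let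
`F = ℚ(φ) ⊆ End⁰(A)` (`P(φ) = 0`, `P ∈ ℤ[T]` monic irreducible of degree `e`, `e · 2m = 2 dim A`, `m ≠ 0`), `h` a
polarization class, and `u ∈ End(A)` with `u^* ∈ ℂ[φ^*]` («`α ∈ F`»), `u^*` central («`α ∈ E`»), `Q_h(u^* x, y) =
-Q_h(x, u^* y)` («`α ∈ E₋`») and `u^* ≠ 0`. Then `W_F ⊗ ℂ ⊓ 𝒟ᵐ ⊗ ℂ = ⊥`. Proof: `w = u^* - (u^*)† = 2u^*` has
`Tr(w | V_ρ) = 2α(ρ) · dim V_ρ ≠ 0` at a root (§2, «obviously have a non-zero trace over `F`»), and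
`WeilClassesFieldExceptionalOfCentralTrace.weilClassesField_inf_divisorClassesSpan_eq_bot_of_trace_ne_zero` applies
(central Cayley transforms in `S(A)(h)(ℂ)` with `det ≠ 1` on `V_ρ`).
[cite: MoonenZarhin1998WeilClasses, §1 Criterion (2) (chunk p0003 L46–L60) and Remark (2) after it (chunk p0004 L48–L53)]
[cite: Milne1999LefschetzClasses, §1 pp. 642–644] -/
theorem weilClassesField_inf_divisorClassesSpan_eq_bot_of_central_skew (h1 : 1 ≤ A.dim)
    (hQ : IsRationalClass h) (h11 : IsOfHodgeType A.dim A.X 2 1 1 h) (hHL : HasHardLefschetzProperty h A.dim)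
    (hPm : P.Monic) (hPe : P.natDegree = e) (hPirr : Irreducible (P.map (Int.castRingHom ℚ)))
    (hφ : Polynomial.eval₂ (Int.castRingHom (CategoryTheory.End A)) (φ : CategoryTheory.End A) P = 0)
    (her : e * (2 * m) = 2 * A.dim) (hm : m ≠ 0)
    {u : A ⟶ A} (huF : pullbackOne A u ∈ Algebra.adjoin ℂ ({pullbackOne A φ} : Set (Module.End ℂ (complexBetti A.X 1))))
    (huC : pullbackOne A u ∈ centralizerAlgebra A)
    (hskew : ∀ x y : complexBetti A.X 1, polarizationPairingOne A.X h (A.dim - 1) (pullbackOne A u x) y =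
      -polarizationPairingOne A.X h (A.dim - 1) x (pullbackOne A u y))
    (hu0 : pullbackOne A u ≠ 0) :
    weilClassesField A φ P (2 * m) ⊓ divisorClassesSpan A.X A.dim m = ⊥ := by
  obtain ⟨ρ, hρ, hw, htr⟩ := exists_root_trace_restrict_ne_zero hPirr hφ huF hu0
  have hY' : ∀ x y : complexBetti A.X 1, polarizationPairingOne A.X h (A.dim - 1) (pullbackOne A u x) y =
      polarizationPairingOne A.X h (A.dim - 1) x ((-pullbackOne A u) y) := fun x y ↦ by
    rw [hskew, LinearMap.neg_apply, map_neg]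
  exact weilClassesField_inf_divisorClassesSpan_eq_bot_of_trace_ne_zero h1 hQ h11 hHL hPm hPe hPirr hφ her hm huC
    hY' hρ hw htr

/-- **No non-zero Weil class of `F` is decomposable** under the same hypotheses (set form of §3).
[cite: MoonenZarhin1998WeilClasses, §1 Criterion (2) and Remark (2) after it (chunks p0003–p0004)] -/
theorem not_mem_divisorClassesSpan_of_central_skew (h1 : 1 ≤ A.dim)
    (hQ : IsRationalClass h) (h11 : IsOfHodgeType A.dim A.X 2 1 1 h) (hHL : HasHardLefschetzProperty h A.dim)
    (hPm : P.Monic) (hPe : P.natDegree = e) (hPirr : Irreducible (P.map (Int.castRingHom ℚ)))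
    (hφ : Polynomial.eval₂ (Int.castRingHom (CategoryTheory.End A)) (φ : CategoryTheory.End A) P = 0)
    (her : e * (2 * m) = 2 * A.dim) (hm : m ≠ 0)
    {u : A ⟶ A} (huF : pullbackOne A u ∈ Algebra.adjoin ℂ ({pullbackOne A φ} : Set (Module.End ℂ (complexBetti A.X 1))))
    (huC : pullbackOne A u ∈ centralizerAlgebra A)
    (hskew : ∀ x y : complexBetti A.X 1, polarizationPairingOne A.X h (A.dim - 1) (pullbackOne A u x) y =
      -polarizationPairingOne A.X h (A.dim - 1) x (pullbackOne A u y))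
    (hu0 : pullbackOne A u ≠ 0) {c : complexBetti A.X (2 * m)} (hcW : c ∈ weilClassesField A φ P (2 * m))
    (hc0 : c ≠ 0) : c ∉ divisorClassesSpan A.X A.dim m := by
  intro hcD
  have hc : c ∈ weilClassesField A φ P (2 * m) ⊓ divisorClassesSpan A.X A.dim m := ⟨hcW, hcD⟩
  rw [weilClassesField_inf_divisorClassesSpan_eq_bot_of_central_skew h1 hQ h11 hHL hPm hPe hPirr hφ her hm huF huC
    hskew hu0, Submodule.mem_bot] at hc
  exact hc0 hc

/-- **«Hodge but exceptional»**: if moreover the multiplicities are balanced (`n_ρ = n_ρ̄` at every complex root —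
Criterion (1), the tree's `Deligne1982.weilClassesField_le_hodgeClassSpan_iff_forall_eigenMultiplicity_eq`), then
`W_F` consists of Hodge classes all of whose non-zero members are exceptional: `W_F ⊗ ℂ ≤ Bᵐ ⊗ ℂ` and
`W_F ⊗ ℂ ⊓ 𝒟ᵐ ⊗ ℂ = ⊥` — Weil's phenomenon for an imaginary central `α ∈ F`, on every complex abelian variety.
[cite: MoonenZarhin1998WeilClasses, §1 Criterion (1), Criterion (2) and Remark (2) (chunks p0001, p0003–p0004)]
[cite: vanGeemen1994HodgeAV, 6.12] -/
theorem weilClassesField_le_hodgeClassSpan_and_inf_eq_bot_of_central_skew (h1 : 1 ≤ A.dim)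
    (hQ : IsRationalClass h) (h11 : IsOfHodgeType A.dim A.X 2 1 1 h) (hHL : HasHardLefschetzProperty h A.dim)
    (hPm : P.Monic) (hPe : P.natDegree = e) (hPirr : Irreducible (P.map (Int.castRingHom ℚ)))
    (hφ : Polynomial.eval₂ (Int.castRingHom (CategoryTheory.End A)) (φ : CategoryTheory.End A) P = 0)
    (her : e * (2 * m) = 2 * A.dim) (hm : m ≠ 0)
    {u : A ⟶ A} (huF : pullbackOne A u ∈ Algebra.adjoin ℂ ({pullbackOne A φ} : Set (Module.End ℂ (complexBetti A.X 1))))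
    (huC : pullbackOne A u ∈ centralizerAlgebra A)
    (hskew : ∀ x y : complexBetti A.X 1, polarizationPairingOne A.X h (A.dim - 1) (pullbackOne A u x) y =
      -polarizationPairingOne A.X h (A.dim - 1) x (pullbackOne A u y))
    (hu0 : pullbackOne A u ≠ 0)
    (hbal : ∀ ρ : ℂ, Polynomial.eval₂ (Int.castRingHom ℂ) ρ P = 0 →
      eigenMultiplicity A φ ρ = eigenMultiplicity A φ (starRingEnd ℂ ρ)) :
    weilClassesField A φ P (2 * m) ≤ hodgeClassSpan A.dim A.X m ∧
      weilClassesField A φ P (2 * m) ⊓ divisorClassesSpan A.X A.dim m = ⊥ :=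
  ⟨(Deligne1982.weilClassesField_le_hodgeClassSpan_iff_forall_eigenMultiplicity_eq hPm hPe hPirr hφ her).2 hbal,
    weilClassesField_inf_divisorClassesSpan_eq_bot_of_central_skew h1 hQ h11 hHL hPm hPe hPirr hφ her hm huF huC
      hskew hu0⟩

/-! ### §4 The generator itself: `φ^*` central and Rosati-antisymmetric (Weil's `k = ℚ(√-d)` inside the centre) -/

/-- `φ^*` lies in `ℂ[φ^*]`. [folklore] -/
private theorem pullbackOne_mem_adjoin_self :
    pullbackOne A φ ∈ Algebra.adjoin ℂ ({pullbackOne A φ} : Set (Module.End ℂ (complexBetti A.X 1))) :=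
  Algebra.subset_adjoin rfl

/-- **CRITERION (2), THE CASE «`F ⊆ E` and `F ⊄ E₀`» THROUGH ITS GENERATOR, for every complex abelian variety**: if
the generator `φ` of `F = ℚ(φ)` is CENTRAL (`φ^* ∈ C(A) ⊗ ℂ`; e.g. `End⁰(A)` commutative — Type 4 with `d = m = 1`)
and ROSATI-ANTISYMMETRIC (`Q_h(φ^* x, y) = -Q_h(x, φ^* y)`; e.g. Weil's `φ² = -d`, `k = ℚ(√-d)` inside the CM centre),
and `φ^* ≠ 0`, then all non-zero classes of `W_F` are exceptional: `W_F ⊗ ℂ ⊓ 𝒟ᵐ ⊗ ℂ = ⊥` (`m ≠ 0`). A subfield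
`F` of the CM field `E` with `F ⊄ E₀` always contains such an element (it is itself CM; the print's Remark (2)).
[cite: MoonenZarhin1998WeilClasses, §1 Criterion (2), case «Type 4, d = 1, m = 1 and F ⊄ E₀» (chunk p0003 L46–L60), and Remark (2)]
[cite: Weil1977HodgeRing, pp. 421–429] [cite: vanGeemen1994HodgeAV, 6.12] -/
theorem weilClassesField_inf_divisorClassesSpan_eq_bot_of_generator_central_skew (h1 : 1 ≤ A.dim)
    (hQ : IsRationalClass h) (h11 : IsOfHodgeType A.dim A.X 2 1 1 h) (hHL : HasHardLefschetzProperty h A.dim)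
    (hPm : P.Monic) (hPe : P.natDegree = e) (hPirr : Irreducible (P.map (Int.castRingHom ℚ)))
    (hφ : Polynomial.eval₂ (Int.castRingHom (CategoryTheory.End A)) (φ : CategoryTheory.End A) P = 0)
    (her : e * (2 * m) = 2 * A.dim) (hm : m ≠ 0)
    (hφC : pullbackOne A φ ∈ centralizerAlgebra A)
    (hφskew : ∀ x y : complexBetti A.X 1, polarizationPairingOne A.X h (A.dim - 1) (pullbackOne A φ x) y =
      -polarizationPairingOne A.X h (A.dim - 1) x (pullbackOne A φ y))
    (hφ0 : pullbackOne A φ ≠ 0) :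
    weilClassesField A φ P (2 * m) ⊓ divisorClassesSpan A.X A.dim m = ⊥ :=
  weilClassesField_inf_divisorClassesSpan_eq_bot_of_central_skew h1 hQ h11 hHL hPm hPe hPirr hφ her hm
    pullbackOne_mem_adjoin_self hφC hφskew hφ0

/-- **Weil's phenomenon, generator form, with Criterion (1)**: under the hypotheses of the previous theorem and
balanced multiplicities `n_ρ = n_ρ̄`, `W_F` consists of exceptional HODGE classes (`W_F ⊗ ℂ ≤ Bᵐ ⊗ ℂ`,
`W_F ⊗ ℂ ⊓ 𝒟ᵐ ⊗ ℂ = ⊥`). [cite: MoonenZarhin1998WeilClasses, §1 Criterion (1)–(2) and Remark (2)]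
[cite: Weil1977HodgeRing, pp. 421–429] [cite: vanGeemen1994HodgeAV, 6.12] -/
theorem weilClassesField_le_hodgeClassSpan_and_inf_eq_bot_of_generator_central_skew (h1 : 1 ≤ A.dim)
    (hQ : IsRationalClass h) (h11 : IsOfHodgeType A.dim A.X 2 1 1 h) (hHL : HasHardLefschetzProperty h A.dim)
    (hPm : P.Monic) (hPe : P.natDegree = e) (hPirr : Irreducible (P.map (Int.castRingHom ℚ)))
    (hφ : Polynomial.eval₂ (Int.castRingHom (CategoryTheory.End A)) (φ : CategoryTheory.End A) P = 0)
    (her : e * (2 * m) = 2 * A.dim) (hm : m ≠ 0)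
    (hφC : pullbackOne A φ ∈ centralizerAlgebra A)
    (hφskew : ∀ x y : complexBetti A.X 1, polarizationPairingOne A.X h (A.dim - 1) (pullbackOne A φ x) y =
      -polarizationPairingOne A.X h (A.dim - 1) x (pullbackOne A φ y))
    (hφ0 : pullbackOne A φ ≠ 0)
    (hbal : ∀ ρ : ℂ, Polynomial.eval₂ (Int.castRingHom ℂ) ρ P = 0 →
      eigenMultiplicity A φ ρ = eigenMultiplicity A φ (starRingEnd ℂ ρ)) :
    weilClassesField A φ P (2 * m) ≤ hodgeClassSpan A.dim A.X m ∧
      weilClassesField A φ P (2 * m) ⊓ divisorClassesSpan A.X A.dim m = ⊥ :=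
  weilClassesField_le_hodgeClassSpan_and_inf_eq_bot_of_central_skew h1 hQ h11 hHL hPm hPe hPirr hφ her hm
    pullbackOne_mem_adjoin_self hφC hφskew hφ0 hbal

end HodgeTheory

end Literature.AlgebraicGeometry.HodgeTheory

end
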